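import Mathlib
import Summits.ResolutionOfSingularities.ResolutionOfSingularities.Theorems.RadicialJungCleanModelsPBasisFieldExchange
import Summits.ResolutionOfSingularities.ResolutionOfSingularities.Theorems.RadicialJungCleanModelsPBasisDualDerivations
import Summits.ResolutionOfSingularities.ResolutionOfSingularities.Theorems.RadicialJungCleanModelsPBasisDerivation
import HarnessLib

/-!
# res-B-lens-5 g7 (lens 5): PROOF of the lead's registered stub `stub_derivation_of_not_mem_adjoin_pow`
# (`Cruxes/CleanModels/Lines/Sketch.lean` rev 20, l. 220; WORKER WANTED, bus 2026-08-29T01:05Z) — a `k`-trivial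
# derivation moving `g₀ ∉ k[K^p]`, with bounded denominators on the finitely generated `A`

Crux of record for this seat: stmt-ResolutionOfSingularities-0549 (FIXED, not restated).  This file is 15917-side support
(CLASS (A) of `stub_cleanLU3Defect`, branch `g₀ ∉ k[K^p]`), written over the tree's `p`-basis library exactly along the route
named in the stub's docstring: a maximal `p`-independent `B₁ ⊆ k'` (image of `k`) over `K^p` has `k' ⊆ K^p[B₁] ⊆ k[K^p] ∌ g₀`
(`exists_maximal_pIndep`), so `B₁ ∪ {g₀}` is `p`-independent (`pIndep_insert`) and extends to a `p`-basis `Γ` of `K` over `K^p`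
(`exists_maximal_pIndep` with `Y = univ`); the dual derivation `∂_{g₀}` (`IsPBasisOver.exists_dual_derivation`) has `∂ g₀ = 1`,
kills `K^p` and `B₁`, hence `k'`; on `A = k[t]` (`t` finite) it takes values in `Σ_{x ∈ t} A · ∂x ⊆ s⁻¹ A` with `s` the product
of the denominators of the `∂x`.

Main result: `derivation_of_not_mem_adjoin_pow` — literally the stub's statement (sorry-free).  The lead may land it verbatim as
`Theorems/RadicialJungCleanModelsStubDerivationOfNotMemAdjoinPow.lean --supports stmt-…-15917` (this seat may not propose Theorems files).
bears_on: LADDER-RESOLUTION:B · [OURS · CANDIDATE] counted 0; nothing here proves resolution in characteristic `p`.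
-/

noncomputable section

set_option linter.dupNamespace false

open Literature.RingTheory.PBasis
open Summit.ResolutionOfSingularities.ResolutionOfSingularities.Theorems.RadicialJung.CleanModels

namespace Summit.ResolutionOfSingularities.ResolutionOfSingularities.Cruxes.DescentPerfectToAll.CpSibling.DerivationStub

section Tools

variable {K : Type} [Field K] (p : ℕ) [Fact p.Prime] [CharP K p]

/-- The empty family is `p`-independent. [folklore] -/
theorem pIndep_empty : ∀ (s : ℕ) (b : Fin s → K), Function.Injective b → (∀ i, b i ∈ (∅ : Set K)) →
    LinearIndependent (frobenius K p).range (fun n : Fin s → Fin p => ∏ i, b i ^ (n i : ℕ)) := by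
  intro s b _ hmem
  rcases Nat.eq_zero_or_pos s with rfl | hs
  · rw [Fintype.linearIndependent_iff]
    intro g hg n
    rw [Finset.sum_eq_single n (fun n' _ hn' => absurd (Subsingleton.elim n' n) hn')
      (fun h => absurd (Finset.mem_univ n) h)] at hg
    simp only [Finset.univ_eq_empty, Finset.prod_empty, Subring.smul_def, smul_eq_mul,
      mul_one] at hg
    exact Subtype.ext hg
  · exact absurd (hmem ⟨0, hs⟩) (Set.notMem_empty _)

/-- A `p`-independent generating set is a `p`-basis over `K^p` (`IsPBasisOver`). [folklore] -/
theorem isPBasisOver_of_pIndep_of_univ_subset {Γ : Set K}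
    (hind : ∀ (s : ℕ) (b : Fin s → K), Function.Injective b → (∀ i, b i ∈ Γ) →
      LinearIndependent (frobenius K p).range (fun n : Fin s → Fin p => ∏ i, b i ^ (n i : ℕ)))
    (hgen : Set.univ ⊆ (Subring.closure (Set.range (frobenius K p) ∪ Γ) : Set K)) :
    IsPBasisOver p (frobenius K p).range Γ := by
  refine ⟨?_, hind⟩
  rw [eq_top_iff]
  intro x _
  rw [Algebra.mem_adjoin_iff]
  have hr : Set.range (algebraMap (frobenius K p).range K) = Set.range (frobenius K p) := by
    ext z
    constructor
    · rintro ⟨⟨w, y, hy⟩, rfl⟩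
      exact ⟨y, hy⟩
    · rintro ⟨y, rfl⟩
      exact ⟨⟨frobenius K p y, y, rfl⟩, rfl⟩
  rw [hr]
  exact hgen (Set.mem_univ x)

/-- A derivation killing `B` kills `K^p[B] = Subring.closure (K^p ∪ B)`. [folklore] -/
theorem derivation_eq_zero_of_mem_closure (D : Derivation ℤ K K) {B : Set K} (hB : ∀ b ∈ B, D b = 0)
    {x : K} (hx : x ∈ Subring.closure (Set.range (frobenius K p) ∪ B)) : D x = 0 := by
  induction hx using Subring.closure_induction with
  | mem y hy =>
    rcases hy with ⟨w, rfl⟩ | hy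
    · rw [frobenius_def]
      exact derivation_pow_char D w
    · exact hB y hy
  | zero => exact map_zero D
  | one => exact D.map_one_eq_zero
  | add a b _ _ ha hb => rw [map_add, ha, hb, add_zero]
  | neg a _ ha => rw [map_neg, ha, neg_zero]
  | mul a b _ _ ha hb => rw [D.leibniz, ha, hb, smul_zero, smul_zero, add_zero]

end Tools

/-- **The stub `stub_derivation_of_not_mem_adjoin_pow`, proved** (statement copied verbatim from `Cruxes/CleanModels/Lines/Sketch.lean`
rev 20): if `g₀ ∉ k[K^p]` there is a derivation `D` of `K = Frac A` with `D g₀ ≠ 0` and `s • D (A) ⊆ A` for some `s ≠ 0`.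
[folklore] -/
theorem derivation_of_not_mem_adjoin_pow :
    ∀ (p : ℕ), p.Prime →
    ∀ (k : Type) [Field k] [CharP k p] (K : Type) [Field K] [Algebra k K] (A : Subalgebra k K), A.FG → IsFractionRing A K →
    ∀ g₀ : K, g₀ ∉ Algebra.adjoin k (Set.range fun y : K => y ^ p) →
    ∃ (D : Derivation ℤ K K) (s : K), s ≠ 0 ∧ (∀ y : K, y ∈ A → s * D y ∈ A) ∧ D g₀ ≠ 0 := by
  intro p hp k _ _ K _ _ A hAfg hfrac g₀ hg₀
  classical
  haveI : Fact p.Prime := ⟨hp⟩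
  haveI : CharP K p := charP_of_injective_algebraMap (algebraMap k K).injective p
  haveI := hfrac
  -- Step 1: a maximal `p`-independent subset `B₁` of the image `k'` of `k`
  obtain ⟨B₁, -, hB₁k, hB₁ind, hk'B₁⟩ :=
    exists_maximal_pIndep p (Set.range (algebraMap k K)) ∅ (Set.empty_subset _) (pIndep_empty p)
  -- Step 2: `K^p[B₁] ⊆ k[K^p] ∌ g₀`
  have hle : Subring.closure (Set.range (frobenius K p) ∪ B₁) ≤
      (Algebra.adjoin k (Set.range fun y : K => y ^ p)).toSubring := by
    rw [Subring.closure_le]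
    rintro x (⟨y, rfl⟩ | hx)
    · exact Algebra.subset_adjoin ⟨y, (frobenius_def ..).symm⟩
    · obtain ⟨c, rfl⟩ := hB₁k hx
      exact Subalgebra.algebraMap_mem _ c
  have hg₀B₁ : g₀ ∉ Subring.closure (Set.range (frobenius K p) ∪ B₁) := fun h => hg₀ (hle h)
  -- Step 3: `B₁ ∪ {g₀}` is `p`-independent and extends to a `p`-basis `Γ`
  have hB₂ind := pIndep_insert p B₁ hB₁ind hg₀B₁
  obtain ⟨Γ, hB₂Γ, -, hΓind, hΓgen⟩ :=
    exists_maximal_pIndep p Set.univ (insert g₀ B₁) (Set.subset_univ _) hB₂ind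
  have hΓ : IsPBasisOver p (frobenius K p).range Γ := isPBasisOver_of_pIndep_of_univ_subset p hΓind hΓgen
  have hg₀Γ : g₀ ∈ Γ := hB₂Γ (Set.mem_insert _ _)
  -- Step 4: the dual derivation at `g₀`
  obtain ⟨D, hDg₀, hDΓ⟩ := IsPBasisOver.exists_dual_derivation hΓ ⟨g₀, hg₀Γ⟩
  -- Step 5: `D` kills `B₁`, hence `k' ⊆ K^p[B₁]`
  have hDB₁ : ∀ b ∈ B₁, D b = 0 := by
    intro b hb
    have hbΓ : b ∈ Γ := hB₂Γ (Set.mem_insert_of_mem _ hb)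
    have hne : (⟨b, hbΓ⟩ : Γ) ≠ ⟨g₀, hg₀Γ⟩ := by
      intro h
      have hbg : b = g₀ := congrArg Subtype.val h
      exact hg₀B₁ (hbg ▸ Subring.subset_closure (Or.inr hb))
    exact hDΓ ⟨b, hbΓ⟩ hne
  have hDk : ∀ c : k, D (algebraMap k K c) = 0 := fun c =>
    derivation_eq_zero_of_mem_closure p D hDB₁ (hk'B₁ ⟨c, rfl⟩)
  -- Step 6: denominators on the finitely generated `A = k[t]`
  obtain ⟨t, ht⟩ := hAfg
  have hfr := fun x : K => IsFractionRing.div_surjective (A := A) (D x)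
  choose a b hb hab using hfr
  have halg : ∀ z : A, algebraMap A K z = (z : K) := fun z => rfl
  have hb0 : ∀ x, ((b x : A) : K) ≠ 0 := fun x h =>
    nonZeroDivisors.ne_zero (hb x) (Subtype.ext h)
  have hDx : ∀ x, D x = ((a x : A) : K) / ((b x : A) : K) := fun x => by
    rw [← halg, ← halg, hab]
  set s : K := ∏ x ∈ t, ((b x : A) : K) with hs
  have hs0 : s ≠ 0 := Finset.prod_ne_zero_iff.mpr fun x _ => hb0 x
  have hA : ∀ z : A, (z : K) ∈ Algebra.adjoin k (↑t : Set K) := fun z => by rw [ht]; exact z.2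
  have hmain : ∀ y : K, y ∈ Algebra.adjoin k (↑t : Set K) → s * D y ∈ Algebra.adjoin k (↑t : Set K) := by
    intro y hy
    induction hy using Algebra.adjoin_induction with
    | mem x hx =>
      have hx' : x ∈ t := by exact_mod_cast hx
      rw [hDx x, hs, ← Finset.mul_prod_erase t (fun x => ((b x : A) : K)) hx']
      have h1 : ((b x : A) : K) * (∏ z ∈ t.erase x, ((b z : A) : K)) * (((a x : A) : K) / ((b x : A) : K)) =
          (∏ z ∈ t.erase x, ((b z : A) : K)) * ((a x : A) : K) := by
        rw [mul_comm ((b x : A) : K), mul_assoc, mul_div_assoc', mul_div_cancel_left₀ _ (hb0 x)]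
      rw [h1]
      exact Subalgebra.mul_mem _ (Subalgebra.prod_mem _ fun z _ => hA (b z)) (hA (a x))
    | algebraMap r =>
      rw [hDk, mul_zero]
      exact Subalgebra.zero_mem _
    | add x y _ _ hx' hy' =>
      rw [map_add, mul_add]
      exact Subalgebra.add_mem _ hx' hy'
    | mul x y hx hy hx' hy' =>
      have h1 : s * D (x * y) = x * (s * D y) + y * (s * D x) := by
        rw [D.leibniz, smul_eq_mul, smul_eq_mul]
        ring
      rw [h1]
      exact Subalgebra.add_mem _ (Subalgebra.mul_mem _ hx hy') (Subalgebra.mul_mem _ hy hx')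
  refine ⟨D, s, hs0, fun y hy => ?_, ?_⟩
  · rw [← ht] at hy ⊢
    exact hmain y hy
  · rw [hDg₀]
    exact one_ne_zero

end Summit.ResolutionOfSingularities.ResolutionOfSingularities.Cruxes.DescentPerfectToAll.CpSibling.DerivationStub
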